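import Summits.QuantumFields.BalabanUV.T4Continuum.Support.ShellMeasureLandauEndAssembledDecayCfLinCoTests
import Summits.QuantumFields.BalabanUV.T4Continuum.Support.ShellMeasureThresholdUnits

/-!
# `T4Continuum.ShellMeasureLiveEndOneCallSlotLevelsCfLinCoTests` — row S107 file 1⁵: THE LIVE-LEVEL END-II WITH R05 RE-SOURCED, R10 AND R11 DISCHARGED (S104 f4 ∘
# the γ8 unit change S90) OVER THE INDEXED, LEVEL-LIFTED FAMILIES, for BOTH runs and every slot — END-I's `hacA`∕`hacB` shape
(cell `pub-balaban`, sub-cell `t4`, spine estimate NE7c (node U5b); NE7c ROUND-2 crew, unit `b2b-balaban-t4-ne7c-formalise-leaf-09`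
gen 13; owner table `t4/b2b-balaban-t4-ne7c-p1/LEAVES-NE7c-P1.md` row **S107** «THE ONE CALL v4 — R05 RE-SOURCED» (R-ne7cp1-g36-9,
booked-ahead leaf-09); ADDITIVE — imports S104 f4 `ShellMeasureLandauEndAssembledDecayCfLinCoTests` (leaf-10-g13) and S90
`ShellMeasureThresholdUnits` ONLY; [folklore]; 0 `def`, 0 `def … : Prop`, 0 sorry, 0 citation tags; the statement is GENERATED from S104 f4's signature by the
S92∕S95∕S102∕S105 script re-pointed — `HOME/b2b-balaban-t4-ne7c-formalise-leaf-09/g13/s102/`)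

HONEST FRAMING.  Finite four-torus programme, rung (B)+1 only — NOT infinite volume, NOT a mass gap, NOT the Clay problem, NOT
summit progress; (B), `BetaPertHyp`, (B^μ) not consumed.  NE7c (`T4IndicatorShell.ShellWeightBound`) is NOT PRINTED in
[Balaban 1983–89] and NOT PROVED; «NE7c ⇐ the named binders» (trigger c3): every binder below is DISPLAYED, asserted by nobody;
no estimate of Bałaban's is discharged; (M1) realized ≠ NE7c.  Equation numbers in comments LOCATE displayed shapes, not
citations.  HONEST DEPENDENCY (cell): continuum YM on T⁴ ⇐ BetaPertH ∧ nine spine estimates (0/9 proved); BetaPertH ⇐ (D1) ∧ (D4)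
∧ CAP+tail; G-an2-4 gates asym, D1 and NE2/3/4.

WHAT IS PROVED ([folklore]).  **`hac_live_of_assembled_decay_levels_cfB7_lin_coTests`**: for a run index `r : Bool`, comparison index `K`, source parameter
`t` and slot `s : σ`, with the slot on its own lattice `(P r K s, jl r K s)` (lattice level `jl`; END-I level `lvl`), EVERY binder
of S104 f4 `slotAC_realized_su2_landauChart_assembled_decay_cfB7_lin_coTests` as a FAMILY — the TYPE families (the (T1)∕(T2)∕(T3) spaces, index
types, the C*-carrier `𝔸`, S78's probability space) and the box∕chart geometry (`lo hi nb Λ m₀ e`, the level `k`, the B7 index sets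
`Sf Sf′ Sw Sw′ Se Se′`) by `(r, K, s)`, every other object (scheme operators, decay kernels, read-outs, real structure, `F`, `u`,
`Jco`, `W`, the background `Ubg`, the core∕collar plaquette sets, [dict], S78's `μ g Aex`, lower bounds) by `(r, K, t, s)`,
hypotheses quantified unguarded over exactly the indices they mention; Bałaban's UNIFORM NUMBERS SHARED across runs and slots; the
six η-scaled numbers `κr κc κwb κcb dbar Kw : Bool → ℕ → ℝ` read at the slot's LATTICE level (S95's LIFT RULE); the profiles
`ε η ρ β : Bool → ℕ → ℝ` ⟹ `∀ r K t s, SlotAntiConcentration ((fieldMeasure (P r K s) (jl r K s) SU2).withDensity (F r K t s))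
(u r K t s ∕ η r (jl r K s)²) (ε r (K − lvl r K s)) (ρ r (lvl r K s)) (S99 f3b's slot constant at (r, K, t, s))` — ONE call of S104
f4 at `(εθ, η) := (ε r (K − lvl r K s), η r (jl r K s))`, then S90 `slotAntiConcentration_thresholdUnits`.  Renamings forced by
END-I's names: classifier index type `ιc`, S78's exponent `Aex`, (SM) letter `zs`; the e-reach's bound variable `b`.
ROW S107 (owner g36 R-ne7cp1-g36-9 «THE ONE CALL v4 — R05 (W-e) RE-SOURCED», booked-ahead to the generator lineage leaf-09): THIS is S105 f1⁗
`ShellMeasureLiveEndOneCallSlotLevelsCfLin.hac_live_of_assembled_decay_levels_cfB7_lin` RE-FIRED over S104 f4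
`ShellMeasureLandauEndAssembledDecayCfLinCoTests.slotAC_realized_su2_landauChart_assembled_decay_cfB7_lin_coTests` (leaf-10-g13).  WHAT LEFT
(R05 RE-SOURCED by S104 f4 — S94's kernel `jco_triple_of_neighbours`: the window `W V := closedBall 0 S` and the kept co-test factor
`Jco V :=` the neighbours' kept (2.17)-indicators on the S-ball, `hJW hJ hJ1 hWS` derived): data `W Jco`, hypotheses `hJW hJ hJ1 hWS`.
WHAT ENTERED (displayed, asserted by nobody): the per-neighbour families — neighbours `N`, index types `κN ιN`, plaquettes `PuN hPuN`,
carrier `AN`, holonomies `holN` read on OUR chart, numbers `θN RN HN δN` with `hRN hθN hδ0N hδ1N hSMN` (class N), and **`hANN`** = the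
neighbours' (AN-bound) along our block's contraction rays (W-a TYPE, class T — the straddling cubes' localized minimisers; WALL §3's
W-e merges into W-a, it is NOT discharged).  Everything else as S105 f1⁗ (R10 + R11 discharged, box host, `κr κc κwb κcb dbar Kw`
level-lifted; `T ↦ TΦ`).
-/

noncomputable section

open Set Metric NormedSpace MeasureTheory Function Finset
open scoped ENNReal

namespace Summit.QuantumFields.BalabanUV.T4Continuum.ShellMeasureLiveEndOneCallSlotLevelsCfLinCoTests

open Literature.MathematicalPhysics.QuantumFieldTheory.Balaban1983to89
open B11Prop6Scheme (Prop4Hyp)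
open GaugeField (GaugeInvariant)
open T4ShellMeasure (SlotAntiConcentration)
open T4CubePoincare (cube)
open T4CubeChartGnomonic (SU2)
open T4CubeChartExp (expFibreChart)
open T4TreeGaugeFixing (NoClosedLoop fixTo)
open T4ShellMeasurePlaquette (expTail₂)
open ShellMeasureLevelAssembly (classifier)
open ShellMeasureMultiGridNorms (WSup)
open ShellMeasurePinnedNorm (pinW)
open ShellMeasureDecayKernelSums (kerOp)
open ShellMeasureLandauHolonomy (solAt landauExp)
open ShellMeasureLandauHolonomyChart (holOf cplx)
open ShellMeasureLandauHolonomySkew (readOutReal)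
open ShellMeasureMultiGridNorms.WSup (toPiL)
open T4AxialGaugeSmallField (boxPlaqs boxBonds)
open T4AxialGaugeFixing (combBonds)
open B7Prop2Explicit (C0 c2' unitaryUnits)
open B7Prop1Local (pdevOn loK bondHiK)
open B7Prop5Flat (BondIn)
open ShellMeasureAverageProp4General (O1cov C2cov)
open ShellMeasureLandauCorrectionB7 (landauCf landauRad)
open ShellMeasureLandauCorrectionReal (skewPi)
open ShellMeasureLandauCfBoxLocal (landauCfBox)
open ShellMeasureThresholdUnits (slotAntiConcentration_thresholdUnits)
open ShellMeasureLandauEndAssembledDecayCfLinCoTests (slotAC_realized_su2_landauChart_assembled_decay_cfB7_lin_coTests)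

open scoped Matrix.Norms.L2Operator

variable {σ : Type*} {n : Type*} [Fintype n] [DecidableEq n] [Nonempty n]

/-- **THE LIVE-LEVEL END-II OF RECORD IN THRESHOLD UNITS, OVER THE INDEXED FAMILIES** (row S107 file 1⁵; see the module
docstring; R11 discharged by S99's kernel junction, the located regularity displayed).  CONDITIONAL on every displayed binder;
nothing PRINTED is asserted; NOT Bałaban's minimiser; NE7c NOT PROVED. [folklore] -/
theorem hac_live_of_assembled_decay_levels_cfB7_lin_coTests
    (P : Bool → ℕ → σ → Params) (jl lvl : Bool → ℕ → σ → ℕ) [∀ r K s, DecidableEq (PBond (P r K s) (jl r K s))]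
    {ε η ρ β : Bool → ℕ → ℝ} (hη : ∀ r j, 0 < η r j) (hε : ∀ r a, 0 < ε r a) (hρ0 : ∀ r j, 0 ≤ ρ r j)
    {𝒴 𝒵 ℬ : Bool → ℕ → σ → Type*} [∀ r K s, NormedAddCommGroup (𝒴 r K s)] [∀ r K s, NormedSpace ℂ (𝒴 r K s)]
    [∀ r K s, CompleteSpace (𝒴 r K s)] [∀ r K s, NormedAddCommGroup (𝒵 r K s)] [∀ r K s, NormedSpace ℂ (𝒵 r K s)]
    [∀ r K s, NormedAddCommGroup (ℬ r K s)] [∀ r K s, NormedSpace ℂ (ℬ r K s)] {𝔸 : Bool → ℕ → σ → Type*}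
    [∀ r K s, CStarAlgebra (𝔸 r K s)] [∀ r K s, Nontrivial (𝔸 r K s)]
    -- the BOX `[lo, hi]` (the block `□^{∼4}`: `nb` unit steps per direction, non-wrapping on the torus) and its a …
    {lo hi : ∀ r K s, Fin (P r K s).d → ℤ} {nb : Bool → ℕ → σ → ℕ} (hn : ∀ r K s, ∀ κ, hi r K s κ ≤ lo r K s κ + nb r K s)
    (hN : ∀ r K s, ∀ κ, hi r K s κ - lo r K s κ < (P r K s).sitesPerDir (jl r K s))
    (Λ : ∀ r K s, Finset (PBond (P r K s) (jl r K s))) (hΛbox : ∀ r K s, ∀ b ∈ Λ r K s, b ∈ boxBonds (lo r K s) (hi r K s))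
    (hΛcomb : ∀ r K s, Disjoint (Λ r K s) (combBonds (lo r K s) (hi r K s))) {m₀ : Bool → ℕ → σ → ℕ}
    (e : ∀ r K s, ↥(Λ r K s) × Fin 3 ≃ Fin (m₀ r K s)) {S : ℝ} (hS : 0 < S) (hSπ : 3 * S ^ 2 < Real.pi ^ 2)
    {F : ∀ r K (t : ℝ) s, GaugeField (P r K s) (jl r K s) SU2 → ℝ≥0∞} (hF : ∀ r K t s, Measurable (F r K t s))
    (hFi : ∀ r K t s, GaugeInvariant (F r K t s)) {u : ∀ r K (t : ℝ) s, GaugeField (P r K s) (jl r K s) SU2 → ℝ}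
    (hu : ∀ r K t s, Measurable (u r K t s)) (hui : ∀ r K t s, GaugeInvariant (u r K t s)) {ιc : Bool → ℕ → σ → Type*}
    {Pu : ∀ r K (t : ℝ) s, Finset (ιc r K s)} (hPu : ∀ r K t s, (Pu r K t s).Nonempty)
    -- ══ R05 SUPPLIED (this file): window `W V := closedBall 0 S`, co-test `Jco V :=` the NEIGHBOURS' KEPT (2.17) …
    {κN : Bool → ℕ → σ → Type*} (N : ∀ r K (t : ℝ) s, Finset (κN r K s)) {ιN : ∀ r K s, κN r K s → Type*}
    {PuN : ∀ r K (t : ℝ) s, (i : κN r K s) → Finset (ιN r K s i)} (hPuN : ∀ r K t s, ∀ i, (PuN r K t s i).Nonempty)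
    {AN : Bool → ℕ → σ → Type*} [∀ r K s, NormedRing (AN r K s)] [∀ r K s, NormedAlgebra ℂ (AN r K s)]
    [∀ r K s, CompleteSpace (AN r K s)]
    (holN : ∀ r K (t : ℝ) s, (i : κN r K s) → GaugeField (P r K s) (jl r K s) SU2 → ιN r K s i → (Fin (m₀ r K s) → ℝ) → AN r K
      s)
    {θN RN HN δN : ∀ r K (t : ℝ) s, κN r K s → ℝ} (hRN : ∀ r K t s, ∀ i ∈ N r K t s, 1 < RN r K t s i)
    (hθN : ∀ r K t s, ∀ i ∈ N r K t s, 0 < θN r K t s i) (hδ0N : ∀ r K t s, ∀ i ∈ N r K t s, 0 ≤ δN r K t s i)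
    (hδ1N : ∀ r K t s, ∀ i ∈ N r K t s, δN r K t s i ≤ 1)
    (hSMN : ∀ r K t s, ∀ i ∈ N r K t s, 36 * HN r K t s i * 1 ^ 2 / (RN r K t s i - 1) ^ 2 ≤ δN r K t s i * θN r K t s i)
    (hANN : ∀ r K t s, ∀ i ∈ N r K t s, ∀ V, ∀ x ∈ closedBall (0 : Fin (m₀ r K s) → ℝ) S, ∀ p ∈ PuN r K t s i, ∃ f : ℂ → AN r K
      s, DifferentiableOn ℂ f (ball 0 (RN r K t s i)) ∧ (∀ w ∈ ball (0 : ℂ) (RN r K t s i), ‖f w‖ ≤ HN r K t s i) ∧ f 0 = 0 ∧ ∀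
      c : ℝ, 0 ≤ c → c ≤ 1 → f (c : ℂ) = holN r K t s i V p (c • x) - 1)
    {δ : ℝ} (𝒢 : ∀ r K (t : ℝ) s, GaugeField (P r K s) (jl r K s) SU2 → (𝒵 r K s →L[ℂ] (𝒴 r K s)))
    (W𝒱 : ∀ r K (t : ℝ) s, GaugeField (P r K s) (jl r K s) SU2 → 𝒴 r K s → 𝒵 r K s) {B₀ C₄ a₃ ε₄ : ℝ}
    (h𝒢 : ∀ r K t s, ∀ V f, ‖𝒢 r K t s V f‖ ≤ B₀ * ‖f‖) (hW : ∀ r K t s, ∀ V, Prop4Hyp (W𝒱 r K t s V) C₄ a₃) (hB₀ : 0 < B₀)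
    (hC₄ : 0 ≤ C₄) (hε₄ : 0 ≤ ε₄) {dL C₁ B₃ ε₁ : ℝ} (hdL : 0 ≤ dL) (hC₁ : 0 ≤ C₁) (hε₁ : 0 ≤ ε₁) (hB₃ : dL ≤ B₃)
    (h1 : 2 * B₀ * C₁ * B₃ * ε₁ ≤ ε₄) (h2 : 4 * ε₄ ≤ a₃) (h3 : 16 * B₀ * C₄ * ε₄ ≤ 1)
    (H₁ : ∀ r K (t : ℝ) s, GaugeField (P r K s) (jl r K s) SU2 → (ℬ r K s →L[ℂ] (𝒴 r K s)))
    (hH₁ : ∀ r K t s, ∀ V B, ‖H₁ r K t s V B‖ ≤ B₀ * ‖B‖)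
    -- ══ R10 SUPPLIED (this file): the u-tuple's coarse-datum map IS a bounded complex-LINEAR map `T V` read on t …
    (TΦ : ∀ r K (t : ℝ) s, GaugeField (P r K s) (jl r K s) SU2 → ((Fin (m₀ r K s) → ℂ) →L[ℂ] (ℬ r K s))) {rΦ : ℝ}
    (hTb : ∀ r K t s, ∀ V, ‖TΦ r K t s V‖ * rΦ < 2 * dL * C₁ * ε₁) (hSr : S < rΦ)
    -- ══ R11 SUPPLIED (row S99, γ14): the THREE Landau-correction letters ARE the tree's `C_k` of [B7] Prop. 4 in …
    (k : Bool → ℕ → σ → ℕ) (Sf Sf' Sw Sw' Se Se' : ∀ r K s, Finset (B7Prop1Explicit.Site (P r K s).d × Fin (P r K s).d))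
    (Ubg : ∀ r K (t : ℝ) s, GaugeField (P r K s) (jl r K s) SU2 → B7Prop1Explicit.Site (P r K s).d → Fin (P r K s).d → (𝔸 r K
      s)ˣ)
    (hUbg : ∀ r K t s, ∀ V x κ, Ubg r K t s V x κ ∈ unitaryUnits (𝔸 r K s)) {α₀ : ℝ} (hα : 0 < α₀)
    (hα3 : ∀ r K s, C0 (P r K s).d * α₀ ≤ 1 / 3) (hα4 : ∀ r K s, 4 * α₀ ≤ c2' (P r K s).d (P r K s).L)
    (hα6 : ∀ r K s, 4 * O1cov (P r K s).d * α₀ ≤ 1 / 3)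
    (h52locw : ∀ r K t s, ∀ V (c : ↥(Sw' r K s)), pdevOn (loK (P r K s).L (k r K s) c.1.1) (bondHiK (P r K s).L (k r K s) c.1.1
      c.1.2) (Ubg r K t s V) < α₀ * ((((P r K s).L : ℝ) ^ k r K s)⁻¹) ^ 2)
    (h52loce : ∀ r K t s, ∀ V (c : ↥(Se' r K s)), pdevOn (loK (P r K s).L (k r K s) c.1.1) (bondHiK (P r K s).L (k r K s) c.1.1
      c.1.2) (Ubg r K t s V) < α₀ * ((((P r K s).L : ℝ) ^ k r K s)⁻¹) ^ 2)
    (ϖe₁ : ∀ r K (t : ℝ) s, ↥(Se r K s) → ℝ) (ϖe₂ : ∀ r K (t : ℝ) s, ↥(Se' r K s) → ℝ)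
    (hϖe₁ : ∀ r K t s, ∀ b, 0 ≤ ϖe₁ r K t s b) (hϖe₂ : ∀ r K t s, ∀ c, 0 ≤ ϖe₂ r K t s c) {r₀e : ℝ}
    (hreache : ∀ r K t s, ∀ (c : ↥(Se' r K s)) (b : ↥(Se r K s)), BondIn (loK (P r K s).L (k r K s) c.1.1) (bondHiK (P r K s).L
      (k r K s) c.1.1 c.1.2) b.1.1 b.1.2 → ϖe₂ r K t s c - r₀e ≤ ϖe₁ r K t s b)
    (ιs : ∀ r K (t : ℝ) s, GaugeField (P r K s) (jl r K s) SU2 → (𝒴 r K s →L[ℂ] (↥(Sf r K s) → 𝔸 r K s)))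
    (hι : ∀ r K t s, ∀ V Y, ‖ιs r K t s V Y‖ ≤ ‖Y‖)
    (Hop : ∀ r K (t : ℝ) s, GaugeField (P r K s) (jl r K s) SU2 → ((↥(Sf' r K s) → 𝔸 r K s) →L[ℂ] (𝒴 r K s)))
    (hH : ∀ r K t s, ∀ V X, ‖Hop r K t s V X‖ ≤ B₀ * ‖X‖) {ε₃ : ℝ} (h18 : ∀ r K s, 18 * C2cov (P r K s).d * B₀ * ε₃ ≤ 1)
    (hcoup : ε₄ + B₀ * (2 * dL * C₁ * ε₁) ≤ ε₃) (h3R : ∀ r K s, 3 * ε₃ ≤ landauRad (P r K s).d (P r K s).L)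
    (ℓs : ∀ r K (t : ℝ) s, ιc r K s → List (𝒴 r K s →L[ℂ] Matrix n n ℂ)) {κr : Bool → ℕ → ℝ} (hκ : ∀ r K s, 0 ≤ κr r (jl r K s))
    (hℓ : ∀ r K t s, ∀ p ∈ Pu r K t s, ∀ ℓ ∈ ℓs r K t s p, ∀ Y, ‖ℓ Y‖ ≤ κr r (jl r K s) * ‖Y‖) {m : ℕ}
    (hlen : ∀ r K t s, ∀ p ∈ Pu r K t s, (ℓs r K t s p).length ≤ m) {κc : Bool → ℕ → ℝ} (hκc : ∀ r K s, 0 ≤ κc r (jl r K s))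
    (hcurl : ∀ r K t s, ∀ p ∈ Pu r K t s, ∀ Y, ‖((ℓs r K t s p).map fun ℓ => ℓ Y).sum‖ ≤ κc r (jl r K s) * ‖Y‖)
    -- ══ (T2) THE WILSON SLOT'S SUPPLIER DATA AT THE READING OF RECORD (file 4 …
    {Λw Λz Λb 𝔖 : Bool → ℕ → σ → Type*} [∀ r K s, Fintype (Λw r K s)] [∀ r K s, DecidableEq (Λw r K s)]
    [∀ r K s, Fintype (Λz r K s)] [∀ r K s, Fintype (Λb r K s)] {𝔄w ℭ 𝔇 : Bool → ℕ → σ → Type*}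
    [∀ r K s, NormedAddCommGroup (𝔄w r K s)] [∀ r K s, NormedSpace ℂ (𝔄w r K s)] [∀ r K s, CompleteSpace (𝔄w r K s)]
    [∀ r K s, NormedAddCommGroup (ℭ r K s)] [∀ r K s, NormedSpace ℂ (ℭ r K s)] [∀ r K s, NormedAddCommGroup (𝔇 r K s)]
    [∀ r K s, NormedSpace ℂ (𝔇 r K s)] {δw : ℝ} (hδw : 0 ≤ δw) (ϖw : ∀ r K (t : ℝ) s, 𝔖 r K s → ℝ)
    (dis : ∀ r K (t : ℝ) s, 𝔖 r K s → 𝔖 r K s → ℝ) (hϖw : ∀ r K t s, ∀ x y, ϖw r K t s x ≤ ϖw r K t s y + dis r K t s x y)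
    (pos : ∀ r K (t : ℝ) s, Λw r K s → 𝔖 r K s) (posz : ∀ r K (t : ℝ) s, Λz r K s → 𝔖 r K s)
    (pos' : ∀ r K (t : ℝ) s, ↥(Sw r K s) → 𝔖 r K s) (posx : ∀ r K (t : ℝ) s, ↥(Sw' r K s) → 𝔖 r K s)
    (posb : ∀ r K (t : ℝ) s, Λb r K s → 𝔖 r K s)
    (k𝒢 : ∀ r K (t : ℝ) s, GaugeField (P r K s) (jl r K s) SU2 → Λw r K s → Λz r K s → (ℭ r K s →L[ℂ] (𝔄w r K s)))
    (kι : ∀ r K (t : ℝ) s, GaugeField (P r K s) (jl r K s) SU2 → ↥(Sw r K s) → Λw r K s → (𝔄w r K s →L[ℂ] (𝔸 r K s)))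
    (kH : ∀ r K (t : ℝ) s, GaugeField (P r K s) (jl r K s) SU2 → Λw r K s → ↥(Sw' r K s) → (𝔸 r K s →L[ℂ] (𝔄w r K s)))
    (kH₁ : ∀ r K (t : ℝ) s, GaugeField (P r K s) (jl r K s) SU2 → Λw r K s → Λb r K s → (𝔇 r K s →L[ℂ] (𝔄w r K s)))
    {c𝒢 δ𝒢 M𝒢 cι δι Mι cH δH MH cH₁ δH₁ MH₁ : ℝ} (hc𝒢 : 0 ≤ c𝒢) (hM𝒢 : 0 ≤ M𝒢)
    (hk𝒢 : ∀ r K t s, ∀ V c b', ‖k𝒢 r K t s V c b'‖ ≤ c𝒢 * Real.exp (-(δ𝒢 * dis r K t s (pos r K t s c) (posz r K t s b'))))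
    (hM𝒢' : ∀ r K t s, ∀ x, ∑ b', Real.exp (-((δ𝒢 - δw) * dis r K t s x (posz r K t s b'))) ≤ M𝒢) (hcι : 0 ≤ cι) (hMι : 0 ≤ Mι)
    (hkι : ∀ r K t s, ∀ V c b', ‖kι r K t s V c b'‖ ≤ cι * Real.exp (-(δι * dis r K t s (pos' r K t s c) (pos r K t s b'))))
    (hMι' : ∀ r K t s, ∀ x, ∑ b', Real.exp (-((δι - δw) * dis r K t s x (pos r K t s b'))) ≤ Mι) (hcH : 0 ≤ cH) (hMH : 0 ≤ MH)
    (hkH : ∀ r K t s, ∀ V c b', ‖kH r K t s V c b'‖ ≤ cH * Real.exp (-(δH * dis r K t s (pos r K t s c) (posx r K t s b'))))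
    (hMH' : ∀ r K t s, ∀ x, ∑ b', Real.exp (-((δH - δw) * dis r K t s x (posx r K t s b'))) ≤ MH) (hcH₁ : 0 ≤ cH₁)
    (hMH₁ : 0 ≤ MH₁)
    (hkH₁ : ∀ r K t s, ∀ V c b', ‖kH₁ r K t s V c b'‖ ≤ cH₁ * Real.exp (-(δH₁ * dis r K t s (pos r K t s c) (posb r K t s b'))))
    (hMH₁' : ∀ r K t s, ∀ x, ∑ b', Real.exp (-((δH₁ - δw) * dis r K t s x (posb r K t s b'))) ≤ MH₁)
    -- the flat lists (P2)∕(P4)∕(118)∕(121)∕(103)∕(75)-TYPE∕(44) at radius `RCw` with `6(ε₄w + B₀w·bw) ≤ RCw`∕scal …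
    (W𝒱w : ∀ r K (t : ℝ) s, GaugeField (P r K s) (jl r K s) SU2 → (Λw r K s → 𝔄w r K s) → (Λz r K s → ℭ r K s))
    {B₀w C₄w a₃w ε₄w bw : ℝ} (h𝒢w : ∀ r K t s, ∀ V f, ‖kerOp (k𝒢 r K t s V) f‖ ≤ B₀w * ‖f‖)
    (hWw : ∀ r K t s, ∀ V, Prop4Hyp (W𝒱w r K t s V) C₄w a₃w) (hB₀w : 0 < B₀w) (hC₄w : 0 ≤ C₄w) (hε₄w : 0 ≤ ε₄w)
    (hdomw : 2 * (ε₄w + B₀w * bw) ≤ a₃w) (hselfw : B₀w * C₄w * (ε₄w + B₀w * bw) ^ 2 ≤ ε₄w)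
    (hcontrw : 4 * B₀w * C₄w * (ε₄w + B₀w * bw) < 1) (hH₁w : ∀ r K t s, ∀ V B, ‖kerOp (kH₁ r K t s V) B‖ ≤ B₀w * ‖B‖)
    -- ══ R10 SUPPLIED: the w-tuple's coarse-datum map is a bounded LINEAR map into the flat pi-type; ONE number r …
    (Tw : ∀ r K (t : ℝ) s, GaugeField (P r K s) (jl r K s) SU2 → ((Fin (m₀ r K s) → ℂ) →L[ℂ] (Λb r K s → 𝔇 r K s))) {rΦw : ℝ}
    (hTbw : ∀ r K t s, ∀ V, ‖Tw r K t s V‖ * rΦw < bw) (h2Sw : 2 * S ≤ rΦw)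
    (hιw : ∀ r K t s, ∀ V Y, ‖kerOp (kι r K t s V) Y‖ ≤ ‖Y‖) (hHw : ∀ r K t s, ∀ V X, ‖kerOp (kH r K t s V) X‖ ≤ B₀w * ‖X‖)
    (hqw : ∀ r K s, 9 * C2cov (P r K s).d * B₀w * (ε₄w + B₀w * bw) < 1)
    (hRCw : ∀ r K s, 6 * (ε₄w + B₀w * bw) ≤ landauRad (P r K s).d (P r K s).L)
    -- localities with reaches, the block support, the two contraction numbers (DISPLAYED arithmetic on the decay …
    (NW : ∀ r K (t : ℝ) s, Λz r K s → Λw r K s → Prop)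
    (hlocW : ∀ r K t s, ∀ V, ∀ A A' : Λw r K s → 𝔄w r K s, ∀ c', (∀ b', NW r K t s c' b' → A b' = A' b') → W𝒱w r K t s V A c' =
      W𝒱w r K t s V A' c')
    {rW : ℝ} (hreachW : ∀ r K t s, ∀ c' b', NW r K t s c' b' → ϖw r K t s (posz r K t s c') - rW ≤ ϖw r K t s (pos r K t s b'))
    {rC : ℝ}
    (hreachC : ∀ r K t s, ∀ (c' : ↥(Sw' r K s)) (b' : ↥(Sw r K s)), BondIn (loK (P r K s).L (k r K s) c'.1.1) (bondHiK (P r K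
      s).L (k r K s) c'.1.1 c'.1.2) b'.1.1 b'.1.2 → ϖw r K t s (posx r K t s c') - rC ≤ ϖw r K t s (pos' r K t s b'))
    (hsupp : ∀ r K t s, ∀ V, ∀ z : Fin (m₀ r K s) → ℂ, ∀ i, 0 < ϖw r K t s (posb r K t s i) → Tw r K t s V z i = 0)
    (hqW : c𝒢 * M𝒢 * (2 * C₄w * a₃w * Real.exp (δw * rW)) < 1)
    (hk : ∀ r K s, 2 * C2cov (P r K s).d * landauRad (P r K s).d (P r K s).L * Real.exp (δw * rC) * (cι * Mι) * (cH * MH) < 1)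
    -- weight plaquettes; read-outs BLIND off located supports, FLAT op-norms, curl op-norm (DISPLAYED; `κ_c ∝ η²` …
    {𝔭 : Bool → ℕ → σ → Type*} (Pw : ∀ r K (t : ℝ) s, Finset (𝔭 r K s))
    (ℓw : ∀ r K (t : ℝ) s, 𝔭 r K s → List ((Λw r K s → 𝔄w r K s) →L[ℂ] Matrix n n ℂ))
    (suppw : ∀ r K (t : ℝ) s, 𝔭 r K s → Finset (Λw r K s)) (ϖPw : ∀ r K (t : ℝ) s, 𝔭 r K s → ℝ)
    (hblindw : ∀ r K t s, ∀ p ∈ Pw r K t s, ∀ ℓ ∈ ℓw r K t s p, ∀ A A' : Λw r K s → 𝔄w r K s, (∀ b' ∈ suppw r K t s p, A b' = A'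
      b') → ℓ A = ℓ A')
    (hdepthw : ∀ r K t s, ∀ p ∈ Pw r K t s, ∀ b' ∈ suppw r K t s p, ϖPw r K t s p ≤ ϖw r K t s (pos r K t s b'))
    (hϖPw : ∀ r K t s, ∀ p ∈ Pw r K t s, 0 ≤ ϖPw r K t s p) {κwb κcb : Bool → ℕ → ℝ} (hκwb : ∀ r K s, 0 ≤ κwb r (jl r K s))
    (hκcb : ∀ r K s, 0 ≤ κcb r (jl r K s)) (hℓwb : ∀ r K t s, ∀ p ∈ Pw r K t s, ∀ ℓ ∈ ℓw r K t s p, ‖ℓ‖ ≤ κwb r (jl r K s))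
    (hcurlw : ∀ r K t s, ∀ p ∈ Pw r K t s, ‖(ℓw r K t s p).sum‖ ≤ κcb r (jl r K s)) {mw : ℕ}
    (hlenw : ∀ r K t s, ∀ p ∈ Pw r K t s, (ℓw r K t s p).length ≤ mw)
    -- the global tuple's real structure with SKEW weight read-outs
    (𝓡𝒴w : ∀ r K (t : ℝ) s, AddSubgroup (Λw r K s → 𝔄w r K s))
    (h𝓡𝒴w : ∀ r K t s, IsClosed (𝓡𝒴w r K t s : Set (Λw r K s → 𝔄w r K s)))
    (𝓡𝒵w : ∀ r K (t : ℝ) s, AddSubgroup (Λz r K s → ℭ r K s)) (𝓡ℬw : ∀ r K (t : ℝ) s, AddSubgroup (Λb r K s → 𝔇 r K s))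
    (h𝒢rw : ∀ r K t s, ∀ V, ∀ f ∈ 𝓡𝒵w r K t s, kerOp (k𝒢 r K t s V) f ∈ 𝓡𝒴w r K t s)
    (hWrw : ∀ r K t s, ∀ V, ∀ Y ∈ 𝓡𝒴w r K t s, W𝒱w r K t s V Y ∈ 𝓡𝒵w r K t s)
    (hιrw : ∀ r K t s, ∀ V, ∀ Y ∈ 𝓡𝒴w r K t s, kerOp (kι r K t s V) Y ∈ skewPi ↥(Sw r K s))
    (hHrw : ∀ r K t s, ∀ V, ∀ X ∈ skewPi (𝔸 := 𝔸 r K s) ↥(Sw' r K s), kerOp (kH r K t s V) X ∈ 𝓡𝒴w r K t s)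
    (hH₁rw : ∀ r K t s, ∀ V, ∀ B ∈ 𝓡ℬw r K t s, kerOp (kH₁ r K t s V) B ∈ 𝓡𝒴w r K t s)
    (hTrw : ∀ r K t s, ∀ V (y : Fin (m₀ r K s) → ℝ), Tw r K t s V (cplx y) ∈ 𝓡ℬw r K t s)
    (hskew : ∀ r K t s, ∀ p ∈ Pw r K t s, ∀ ℓ ∈ ℓw r K t s p, ∀ Y ∈ 𝓡𝒴w r K t s, ℓ Y ∈ skewAdjoint (Matrix n n ℂ))
    -- the frozen background plaquettes (N-ne7cp1-g31-2) with a uniform size bound, the located count, `0 ≤ β`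
    (Bp : ∀ r K (t : ℝ) s, GaugeField (P r K s) (jl r K s) SU2 → 𝔭 r K s → Matrix n n ℂ) {d : ∀ r K (t : ℝ) s, 𝔭 r K s → ℝ}
    {dbar : Bool → ℕ → ℝ} (hBu : ∀ r K t s, ∀ V, ∀ p ∈ Pw r K t s, Bp r K t s V p ∈ unitary (Matrix n n ℂ))
    (hBd : ∀ r K t s, ∀ V, ∀ p ∈ Pw r K t s, ‖Bp r K t s V p - 1‖ ≤ d r K t s p)
    (hd : ∀ r K t s, ∀ p ∈ Pw r K t s, d r K t s p ≤ dbar r (jl r K s)) (hdbar : ∀ r K s, 0 ≤ dbar r (jl r K s))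
    {Kw : Bool → ℕ → ℝ} (hKw : ∀ r K t s, ∑ p ∈ Pw r K t s, Real.exp (-(δw * ϖPw r K t s p)) ≤ Kw r (jl r K s))
    -- ══ (T3) THE LOCATED NON-WILSON TERMS' SUPPLIER DATA (S71 f2 `hE_landau_chartRay_pinned`): the global tuple' …
    {Λe : Bool → ℕ → σ → Type*} [∀ r K s, Fintype (Λe r K s)] {𝔄 : Bool → ℕ → σ → Type*} [∀ r K s, NormedAddCommGroup (𝔄 r K s)]
    [∀ r K s, NormedSpace ℂ (𝔄 r K s)] [∀ r K s, CompleteSpace (𝔄 r K s)] {δ' : ℝ} {ϖ : ∀ r K (t : ℝ) s, Λe r K s → ℝ}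
    (hδ' : 0 ≤ δ') (hϖ : ∀ r K t s, ∀ b', 0 ≤ ϖ r K t s b') {𝒵e ℬe : Bool → ℕ → σ → Type*}
    [∀ r K s, NormedAddCommGroup (𝒵e r K s)] [∀ r K s, NormedSpace ℂ (𝒵e r K s)] [∀ r K s, NormedAddCommGroup (ℬe r K s)]
    [∀ r K s, NormedSpace ℂ (ℬe r K s)]
    (𝒢e : ∀ r K t s, GaugeField (P r K s) (jl r K s) SU2 → (𝒵e r K s →L[ℂ] WSup (pinW δ' (ϖ r K t s)) 1 (𝔄 r K s)))
    (W𝒱e : ∀ r K t s, GaugeField (P r K s) (jl r K s) SU2 → WSup (pinW δ' (ϖ r K t s)) 1 (𝔄 r K s) → 𝒵e r K s)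
    {B₀e C₄e a₃e be ε₄e : ℝ} (h𝒢e : ∀ r K t s, ∀ V f, ‖𝒢e r K t s V f‖ ≤ B₀e * ‖f‖)
    (hWe : ∀ r K t s, ∀ V, Prop4Hyp (W𝒱e r K t s V) C₄e a₃e) (hB₀e : 0 < B₀e) (hC₄e : 0 ≤ C₄e) (hbe : 0 ≤ be) (hε₄e : 0 ≤ ε₄e)
    (hdome : 2 * (ε₄e + B₀e * be) ≤ a₃e) (hselfe : B₀e * C₄e * (ε₄e + B₀e * be) ^ 2 ≤ ε₄e)
    (hcontre : 4 * B₀e * C₄e * (ε₄e + B₀e * be) < 1)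
    (H₁e : ∀ r K t s, GaugeField (P r K s) (jl r K s) SU2 → (ℬe r K s →L[ℂ] WSup (pinW δ' (ϖ r K t s)) 1 (𝔄 r K s)))
    (hH₁e : ∀ r K t s, ∀ V B, ‖H₁e r K t s V B‖ ≤ B₀e * ‖B‖)
    -- ══ R10 SUPPLIED: the e-tuple's coarse-datum map is a bounded LINEAR map; ONE number relation ══
    (Te : ∀ r K (t : ℝ) s, GaugeField (P r K s) (jl r K s) SU2 → ((Fin (m₀ r K s) → ℂ) →L[ℂ] (ℬe r K s))) {rΦe : ℝ}
    (hTbe : ∀ r K t s, ∀ V, ‖Te r K t s V‖ * rΦe < be) (hSre : S < rΦe)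
    (ιe : ∀ r K t s, GaugeField (P r K s) (jl r K s) SU2 → (WSup (pinW δ' (ϖ r K t s)) 1 (𝔄 r K s) →L[ℂ] WSup (pinW δ' (ϖe₁ r K
      t s)) 1 (𝔸 r K s)))
    (hιe : ∀ r K t s, ∀ V Y, ‖ιe r K t s V Y‖ ≤ ‖Y‖)
    (He : ∀ r K t s, GaugeField (P r K s) (jl r K s) SU2 → (WSup (pinW δ' (ϖe₂ r K t s)) 1 (𝔸 r K s) →L[ℂ] WSup (pinW δ' (ϖ r K
      t s)) 1 (𝔄 r K s)))
    (hHe : ∀ r K t s, ∀ V X, ‖He r K t s V X‖ ≤ B₀e * ‖X‖)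
    (hqe : ∀ r K s, 9 * (C2cov (P r K s).d * Real.exp (2 * δ' * r₀e)) * B₀e * (ε₄e + B₀e * be) < 1)
    (hRCe : ∀ r K s, 3 * (ε₄e + B₀e * be) ≤ landauRad (P r K s).d (P r K s).L) {𝔱 : Bool → ℕ → σ → Type*}
    (I : ∀ r K (t : ℝ) s, Finset (𝔱 r K s)) {Ef : ∀ r K (t : ℝ) s, 𝔱 r K s → (Λe r K s → 𝔄 r K s) → ℂ} {rE : ℝ}
    {ee : ∀ r K (t : ℝ) s, 𝔱 r K s → ℝ} (hrE : 0 < rE)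
    (hEd : ∀ r K t s, ∀ i ∈ I r K t s, DifferentiableOn ℂ (Ef r K t s i) (ball 0 rE))
    (hEb : ∀ r K t s, ∀ i ∈ I r K t s, ∀ Z ∈ ball (0 : Λe r K s → 𝔄 r K s) rE, ‖Ef r K t s i Z‖ ≤ ee r K t s i)
    (he0 : ∀ r K t s, ∀ i ∈ I r K t s, 0 ≤ ee r K t s i) (supp : ∀ r K (t : ℝ) s, 𝔱 r K s → Finset (Λe r K s))
    (hblind : ∀ r K t s, ∀ i ∈ I r K t s, ∀ A₁ A₂ : Λe r K s → 𝔄 r K s, (∀ b' ∈ supp r K t s i, A₁ b' = A₂ b') → Ef r K t s i A₁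
      = Ef r K t s i A₂)
    (ϖP : ∀ r K (t : ℝ) s, 𝔱 r K s → ℝ)
    (hdepth : ∀ r K t s, ∀ i ∈ I r K t s, ∀ b' ∈ supp r K t s i, ϖP r K t s i ≤ ϖ r K t s b') {LK : ℝ} (hLK : 0 ≤ LK)
    (hK : ∀ r K t s, ∑ i ∈ I r K t s, 2 * ee r K t s i / rE * Real.exp (-(δ' * ϖP r K t s i)) ≤ LK)
    (hcoupE : ∀ r K s, ((ε₄e + B₀e * be) + B₀e * (4 * (C2cov (P r K s).d * Real.exp (2 * δ' * r₀e)) * (ε₄e + B₀e * be) ^ 2)) ≤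
      rE / 2)
    {BE₁ : ℝ}
    (hElb₁ : ∀ r K t s, ∀ V (y : Fin (m₀ r K s) → ℝ), ‖y‖ ≤ S → -BE₁ ≤ (∑ i ∈ I r K t s, Ef r K t s i (WSup.toPiL (𝔄 := 𝔄 r K s)
      (pinW δ' (ϖ r K t s)) 1 (landauExp (fun Y : WSup (pinW δ' (ϖe₁ r K t s)) 1 (𝔸 r K s) => ((toPiL (pinW δ' (ϖe₂ r K t s))
      1).symm (landauCf (P r K s).L (Ubg r K t s V) (k r K s) (Se r K s) (Se' r K s) (toPiL (pinW δ' (ϖe₁ r K t s)) 1 Y)) : WSup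
      (pinW δ' (ϖe₂ r K t s)) 1 (𝔸 r K s))) (ιe r K t s V) (He r K t s V) (4 * (C2cov (P r K s).d * Real.exp (2 * δ' * r₀e)) *
      (ε₄e + B₀e * be) ^ 2) (solAt (𝒢e r K t s V) 0 (W𝒱e r K t s V) ε₄e (0 : 𝒵e r K s) (H₁e r K t s V (Te r K t s V (cplx y))) +
      H₁e r K t s V (Te r K t s V (cplx y)))))).re)
    -- ══ (S78) THE FLUCTUATION-DRESSED TERMS: `−log ∫ g e^{A} dμ` with an ω-UNIFORM ray constant `B_d`, integrabi …
    {Ω : Bool → ℕ → σ → Type*} [∀ r K s, MeasurableSpace (Ω r K s)] (μ : ∀ r K (t : ℝ) s, Measure (Ω r K s))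
    {g : ∀ r K (t : ℝ) s, Ω r K s → ℝ} (hg : ∀ r K t s, ∀ ω, 0 ≤ g r K t s ω)
    (Aex : ∀ r K (t : ℝ) s, GaugeField (P r K s) (jl r K s) SU2 → (Fin (m₀ r K s) → ℝ) → Ω r K s → ℝ) {Bd : ℝ} (hBd0 : 0 ≤ Bd)
    (hint : ∀ r K t s, ∀ V, ∀ x ∈ closedBall (0 : Fin (m₀ r K s) → ℝ) S, ∀ c : ℝ, 1 / 2 ≤ c → c ≤ 1 → Integrable (fun ω => g r K
      t s ω * Real.exp (Aex r K t s V (c • x) ω)) (μ r K t s))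
    (hpos : ∀ r K t s, ∀ V, ∀ x ∈ closedBall (0 : Fin (m₀ r K s) → ℝ) S, ∀ c : ℝ, 1 / 2 ≤ c → c ≤ 1 → 0 < ∫ ω, g r K t s ω *
      Real.exp (Aex r K t s V (c • x) ω) ∂(μ r K t s))
    (hA : ∀ r K t s, ∀ V, ∀ x ∈ closedBall (0 : Fin (m₀ r K s) → ℝ) S, ∀ c : ℝ, 1 / 2 ≤ c → c ≤ 1 → ∀ ω, Aex r K t s V x ω ≤ Aex
      r K t s V (c • x) ω + (1 - c) * Bd)
    {BE₂ : ℝ}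
    (hElb₂ : ∀ r K t s, ∀ V (y : Fin (m₀ r K s) → ℝ), ‖y‖ ≤ S → -BE₂ ≤ (-Real.log (∫ ω, g r K t s ω * Real.exp (Aex r K t s V y
      ω) ∂(μ r K t s))))
    (L : ∀ r K (t : ℝ) s, Set (𝒴 r K s →L[ℂ] Matrix n n ℂ)) (𝓡𝒵 : ∀ r K (t : ℝ) s, AddSubgroup (𝒵 r K s))
    (𝓡ℬ : ∀ r K (t : ℝ) s, AddSubgroup (ℬ r K s))
    (h𝒢r : ∀ r K t s, ∀ V, ∀ f ∈ 𝓡𝒵 r K t s, 𝒢 r K t s V f ∈ readOutReal (L r K t s))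
    (hWr : ∀ r K t s, ∀ V, ∀ Y ∈ readOutReal (L r K t s), W𝒱 r K t s V Y ∈ 𝓡𝒵 r K t s)
    (hιr : ∀ r K t s, ∀ V, ∀ Y ∈ readOutReal (L r K t s), ιs r K t s V Y ∈ skewPi ↥(Sf r K s))
    (hHr : ∀ r K t s, ∀ V, ∀ X ∈ skewPi (𝔸 := 𝔸 r K s) ↥(Sf' r K s), Hop r K t s V X ∈ readOutReal (L r K t s))
    (hH₁r : ∀ r K t s, ∀ V, ∀ B ∈ 𝓡ℬ r K t s, H₁ r K t s V B ∈ readOutReal (L r K t s))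
    (hTr : ∀ r K t s, ∀ V (y : Fin (m₀ r K s) → ℝ), TΦ r K t s V (cplx y) ∈ 𝓡ℬ r K t s)
    (hRdict : ∀ r K t s, ∀ V, ∀ x ∈ cube (m₀ r K s) S, F r K t s (fixTo (combBonds (lo r K s) (hi r K s)) 1 (updateFinset V (Λ r
      K s) (expFibreChart (Λ r K s) 1 (e r K s) x))) = (closedBall (0 : Fin (m₀ r K s) → ℝ) S ∩ ⋂ i ∈ N r K t s, {y | classifier
      (hPuN r K t s i) (holN r K t s i V) y < θN r K t s i}).indicator (1 : (Fin (m₀ r K s) → ℝ) → ℝ≥0∞) x * ENNReal.ofReal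
      (Real.exp (-((∑ p ∈ Pw r K t s, β r (jl r K s) * (1 - (Matrix.trace (Bp r K t s V p * holOf (ℓw r K t s p) (fun y =>
      landauExp (landauCfBox (P r K s).L (Ubg r K t s V) (k r K s) (Sw r K s) (Sw' r K s) (landauRad (P r K s).d (P r K s).L))
      (kerOp (kι r K t s V)) (kerOp (kH r K t s V)) (4 * C2cov (P r K s).d * (ε₄w + B₀w * bw) ^ 2) (solAt (kerOp (k𝒢 r K t s V))
      0 (W𝒱w r K t s V) ε₄w (0 : Λz r K s → ℭ r K s) (kerOp (kH₁ r K t s V) (Tw r K t s V (cplx y))) + kerOp (kH₁ r K t s V) (Tw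
      r K t s V (cplx y)))) x)).re / Fintype.card n)) + ((∑ i ∈ I r K t s, Ef r K t s i (WSup.toPiL (𝔄 := 𝔄 r K s) (pinW δ' (ϖ r
      K t s)) 1 (landauExp (fun Y : WSup (pinW δ' (ϖe₁ r K t s)) 1 (𝔸 r K s) => ((toPiL (pinW δ' (ϖe₂ r K t s)) 1).symm
      (landauCf (P r K s).L (Ubg r K t s V) (k r K s) (Se r K s) (Se' r K s) (toPiL (pinW δ' (ϖe₁ r K t s)) 1 Y)) : WSup (pinW
      δ' (ϖe₂ r K t s)) 1 (𝔸 r K s))) (ιe r K t s V) (He r K t s V) (4 * (C2cov (P r K s).d * Real.exp (2 * δ' * r₀e)) * (ε₄e +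
      B₀e * be) ^ 2) (solAt (𝒢e r K t s V) 0 (W𝒱e r K t s V) ε₄e (0 : 𝒵e r K s) (H₁e r K t s V (Te r K t s V (cplx x))) + H₁e r
      K t s V (Te r K t s V (cplx x)))))).re + (-Real.log (∫ ω, g r K t s ω * Real.exp (Aex r K t s V x ω) ∂(μ r K t s))))))))
    (hudict : ∀ r K t s, ∀ V, ∀ x ∈ cube (m₀ r K s) S, u r K t s (fixTo (combBonds (lo r K s) (hi r K s)) 1 (updateFinset V (Λ r
      K s) (expFibreChart (Λ r K s) 1 (e r K s) x))) = classifier (hPu r K t s) (fun p => holOf (ℓs r K t s p) (fun y =>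
      landauExp ((ball (0 : ↥(Sf r K s) → 𝔸 r K s) (landauRad (P r K s).d (P r K s).L)).indicator (landauCf (P r K s).L (1 :
      B7Prop1Explicit.Site (P r K s).d → Fin (P r K s).d → (𝔸 r K s)ˣ) (k r K s) (Sf r K s) (Sf' r K s))) (ιs r K t s V) (Hop r
      K t s V) (4 * C2cov (P r K s).d * (ε₄ + B₀ * (2 * dL * C₁ * ε₁)) ^ 2) (solAt (𝒢 r K t s V) 0 (W𝒱 r K t s V) ε₄ (0 : 𝒵 r K
      s) (H₁ r K t s V (TΦ r K t s V (cplx y))) + H₁ r K t s V (TΦ r K t s V (cplx y))))) x)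
    (hδ0 : 0 ≤ δ) (hδ1 : δ < 1)
    -- SM-L2 (SM) DISCHARGED IN THE STOKES CURRENCY (S73 `hSM_of_stokes`): the η-scalings of the classifier's read …
    {c₁ c₂ zs : ℝ}
    (hs₁ : ∀ r K s, κc r (jl r K s) * ((ε₄ + B₀ * (2 * dL * C₁ * ε₁)) + B₀ * (4 * C2cov (P r K s).d * (ε₄ + B₀ * (2 * dL * C₁ *
      ε₁)) ^ 2)) ≤ c₁ * η r (jl r K s) ^ 2 * zs)
    (ha : ∀ r K s, κr r (jl r K s) * ((ε₄ + B₀ * (2 * dL * C₁ * ε₁)) + B₀ * (4 * C2cov (P r K s).d * (ε₄ + B₀ * (2 * dL * C₁ *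
      ε₁)) ^ 2)) ≤ c₂ * η r (jl r K s) * zs)
    (hma : ∀ r K s, m * (κr r (jl r K s) * ((ε₄ + B₀ * (2 * dL * C₁ * ε₁)) + B₀ * (4 * C2cov (P r K s).d * (ε₄ + B₀ * (2 * dL *
      C₁ * ε₁)) ^ 2))) ≤ 1)
    (hsm : ∀ r K s, 36 * (c₁ * zs + m ^ 2 * c₂ ^ 2 * zs ^ 2) / (rΦ / S - 1) ^ 2 ≤ δ * ε r (K - lvl r K s))
    -- THE DISPLAYED γ3 INPUT OF RECORD (N-ne7cp1-g32-2 ∕ N-ne7cp1-g33-2 «COLLAR»; leaf-01-g8 l.18489, leaf-08-g14 …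
    {a : ℝ} (ha0 : 0 ≤ a) (hrad : ∀ r K s, (((P r K s).d - 1 : ℕ) : ℝ) * nb r K s * a ≤ 2 * Real.sin (S / 2))
    {Pcore Pcollar : ∀ r K (t : ℝ) s, Set (Plaq (P r K s) (jl r K s))}
    (hcover : ∀ r K t s, boxPlaqs (lo r K s) (hi r K s) ⊆ Pcore r K t s ∪ (Pcollar r K t s))
    (hcore : ∀ r K t s, ∀ (V : GaugeField (P r K s) (jl r K s) SU2) (y : ↥(Λ r K s) → SU2), u r K t s (fixTo (combBonds (lo r K
      s) (hi r K s)) 1 (updateFinset V (Λ r K s) y)) < ε r (K - lvl r K s) * η r (jl r K s) ^ 2 → PlaqSmallOn (Pcore r K t s) a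
      (fixTo (combBonds (lo r K s) (hi r K s)) 1 (updateFinset V (Λ r K s) y)))
    (hcollar : ∀ r K t s, ∀ (V : GaugeField (P r K s) (jl r K s) SU2) (y : ↥(Λ r K s) → SU2), F r K t s (fixTo (combBonds (lo r
      K s) (hi r K s)) 1 (updateFinset V (Λ r K s) y)) ≠ 0 → PlaqSmallOn (Pcollar r K t s) a (fixTo (combBonds (lo r K s) (hi r
      K s)) 1 (updateFinset V (Λ r K s) y)))
    (hρ : ∀ r j, ρ r j ≤ (1 - δ) / 2) (hβ : ∀ r j, 0 ≤ β r j)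
    :
    ∀ (r : Bool) (K : ℕ) (t : ℝ) (s : σ), SlotAntiConcentration ((fieldMeasure (P r K s) (jl r K s) SU2).withDensity (F r K t
      s)) (fun U => u r K t s U / η r (jl r K s) ^ 2) (ε r (K - lvl r K s)) (ρ r (lvl r K s)) (2 * ((m₀ r K s : ℝ) + (3 * (|β r
      (jl r K s)| * ((dbar r (jl r K s) + 2 * (κcb r (jl r K s) * (cH₁ * MH₁ * bw / ((1 - c𝒢 * M𝒢 * (2 * C₄w * a₃w * Real.exp
      (δw * rW))) * (1 - 2 * C2cov (P r K s).d * landauRad (P r K s).d (P r K s).L * Real.exp (δw * rC) * (cι * Mι) * (cH *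
      MH)))) + expTail₂ (mw * (κwb r (jl r K s) * (cH₁ * MH₁ * bw / ((1 - c𝒢 * M𝒢 * (2 * C₄w * a₃w * Real.exp (δw * rW))) * (1 -
      2 * C2cov (P r K s).d * landauRad (P r K s).d (P r K s).L * Real.exp (δw * rC) * (cι * Mι) * (cH * MH))))))) / (rΦw / S))
      * (2 * (κcb r (jl r K s) * (cH₁ * MH₁ * bw / ((1 - c𝒢 * M𝒢 * (2 * C₄w * a₃w * Real.exp (δw * rW))) * (1 - 2 * C2cov (P r K
      s).d * landauRad (P r K s).d (P r K s).L * Real.exp (δw * rC) * (cι * Mι) * (cH * MH)))) + expTail₂ (mw * (κwb r (jl r K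
      s) * (cH₁ * MH₁ * bw / ((1 - c𝒢 * M𝒢 * (2 * C₄w * a₃w * Real.exp (δw * rW))) * (1 - 2 * C2cov (P r K s).d * landauRad (P r
      K s).d (P r K s).L * Real.exp (δw * rC) * (cι * Mι) * (cH * MH))))))) / (rΦw / S))) * Kw r (jl r K s)) + (3 * (LK * (2 *
      ((ε₄e + B₀e * be) + B₀e * (4 * (C2cov (P r K s).d * Real.exp (2 * δ' * r₀e)) * (ε₄e + B₀e * be) ^ 2)))) / (rΦe / S - 1) +
      Bd))) / (1 - δ)) :=
  fun r K t s => slotAntiConcentration_thresholdUnits (hη r (jl r K s))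
    (slotAC_realized_su2_landauChart_assembled_decay_cfB7_lin_coTests (hn r K s) (hN r K s) (Λ r K s) (hΛbox r K s) (hΛcomb r K
      s) (e r K s) hS hSπ (hF r K t s) (hFi r K t s) (hu r K t s) (hui r K t s) (hPu r K t s) (N r K t s) (hPuN r K t s) (holN r
      K t s) (hRN r K t s) (hθN r K t s) (hδ0N r K t s) (hδ1N r K t s) (hSMN r K t s) (hANN r K t s) (𝒢 r K t s) (W𝒱 r K t s)
      (h𝒢 r K t s) (hW r K t s) hB₀ hC₄ hε₄ hdL hC₁ hε₁ hB₃ h1 h2 h3 (H₁ r K t s) (hH₁ r K t s) (TΦ r K t s) (hTb r K t s) hSr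
      (k r K s) (Sf r K s) (Sf' r K s) (Sw r K s) (Sw' r K s) (Se r K s) (Se' r K s) (Ubg r K t s) (hUbg r K t s) hα (hα3 r K s)
      (hα4 r K s) (hα6 r K s) (h52locw r K t s) (h52loce r K t s) (ϖe₁ r K t s) (ϖe₂ r K t s) (hϖe₁ r K t s) (hϖe₂ r K t s)
      (hreache r K t s) (ιs r K t s) (hι r K t s) (Hop r K t s) (hH r K t s) (h18 r K s) hcoup (h3R r K s) (ℓs r K t s) (hκ r K
      s) (hℓ r K t s) (hlen r K t s) (hκc r K s) (hcurl r K t s) hδw (ϖw r K t s) (dis r K t s) (hϖw r K t s) (pos r K t s)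
      (posz r K t s) (pos' r K t s) (posx r K t s) (posb r K t s) (k𝒢 r K t s) (kι r K t s) (kH r K t s) (kH₁ r K t s) hc𝒢 hM𝒢
      (hk𝒢 r K t s) (hM𝒢' r K t s) hcι hMι (hkι r K t s) (hMι' r K t s) hcH hMH (hkH r K t s) (hMH' r K t s) hcH₁ hMH₁ (hkH₁ r K
      t s) (hMH₁' r K t s) (W𝒱w r K t s) (h𝒢w r K t s) (hWw r K t s) hB₀w hC₄w hε₄w hdomw hselfw hcontrw (hH₁w r K t s) (Tw r K
      t s) (hTbw r K t s) h2Sw (hιw r K t s) (hHw r K t s) (hqw r K s) (hRCw r K s) (NW r K t s) (hlocW r K t s) (hreachW r K t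
      s) (hreachC r K t s) (hsupp r K t s) hqW (hk r K s) (Pw r K t s) (ℓw r K t s) (suppw r K t s) (ϖPw r K t s) (hblindw r K t
      s) (hdepthw r K t s) (hϖPw r K t s) (hκwb r K s) (hκcb r K s) (hℓwb r K t s) (hcurlw r K t s) (hlenw r K t s) (𝓡𝒴w r K t
      s) (h𝓡𝒴w r K t s) (𝓡𝒵w r K t s) (𝓡ℬw r K t s) (h𝒢rw r K t s) (hWrw r K t s) (hιrw r K t s) (hHrw r K t s) (hH₁rw r K t s)
      (hTrw r K t s) (hskew r K t s) (Bp r K t s) (hBu r K t s) (hBd r K t s) (hd r K t s) (hdbar r K s) (hKw r K t s) hδ' (hϖ r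
      K t s) (𝒢e r K t s) (W𝒱e r K t s) (h𝒢e r K t s) (hWe r K t s) hB₀e hC₄e hbe hε₄e hdome hselfe hcontre (H₁e r K t s) (hH₁e
      r K t s) (Te r K t s) (hTbe r K t s) hSre (ιe r K t s) (hιe r K t s) (He r K t s) (hHe r K t s) (hqe r K s) (hRCe r K s)
      (I r K t s) hrE (hEd r K t s) (hEb r K t s) (he0 r K t s) (supp r K t s) (hblind r K t s) (ϖP r K t s) (hdepth r K t s)
      hLK (hK r K t s) (hcoupE r K s) (hElb₁ r K t s) (μ r K t s) (hg r K t s) (Aex r K t s) hBd0 (hint r K t s) (hpos r K t s)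
      (hA r K t s) (hElb₂ r K t s) (L r K t s) (𝓡𝒵 r K t s) (𝓡ℬ r K t s) (h𝒢r r K t s) (hWr r K t s) (hιr r K t s) (hHr r K t s)
      (hH₁r r K t s) (hTr r K t s) (hRdict r K t s) (hudict r K t s) hδ0 hδ1 (hρ0 r (lvl r K s)) (hρ r (lvl r K s)) (hβ r (jl r
      K s)) (hη r (jl r K s)) (hε r (K - lvl r K s)) (hs₁ r K s) (ha r K s) (hma r K s) (hsm r K s) ha0 (hrad r K s) (hcover r K
      t s) (hcore r K t s) (hcollar r K t s))

end Summit.QuantumFields.BalabanUV.T4Continuum.ShellMeasureLiveEndOneCallSlotLevelsCfLinCoTests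

end
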